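import Summits.AtomisticToContinuum.HydrodynamicLimit.Theorems.CorrectorPressureDecay.Negative.FreeFlow
import Summits.AtomisticToContinuum.HydrodynamicLimit.Theorems.CorrectorPressureDecay.Negative.Frame
import Summits.AtomisticToContinuum.HydrodynamicLimit.Theorems.OneSphereInfluenceStaticScoreResponseGaussMoments
import HarnessLib

/-!
# `HydroLimitInBand` (crux stmt-AtomisticToContinuum-9133), negative side, line `IdeatorOneSketch`:
# the KINETIC window-LD input is FALSE at the collisionless endpoint `σ = 0`

Standing disprover's lemma (`Cruxes/HydroLimitInBand/Disproof.lean`, `-- Line IdeatorOneSketch`, refuter-cdisprove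
lineage of stmt-9133, gen 2). The line's ledger consumes the family-uniform kinetic-currents window large-deviation input
`IdeatorOneSketch.KineticCurrentsWindowLDFamily` (skeleton v8/v9; the family-uniform typing of the board item
`OneFlightGossipEngine.KineticCurrentsWindowLDUniform`, stmt-14662): for fast kinetic currents `F ⊥ 1, v, |v|²` the
scale-`N` exponential moment of the WINDOW AVERAGE `w_N⁻¹ ∫₀^{w_N} F(z_i(r)) dr`, `w_N = τ (N+1)^{-1/3}`, under the local
Gibbs law is `≤ e^{ε(N+1)}` for every `ε > 0` once `τ ≥ τ₀(ε)`. Its only mechanism is COLLISIONAL decorrelation inside the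
window. This file decides the side condition `0 < σ` of that input:

* (from the tree, `CorrectorPressureDecayNegative.lintegral_exp_sum_vel_localGibbsMeasure`, `Negative/Frame.lean` of the
  sibling crux) under a homogeneous local Gibbs measure the velocities are i.i.d. Gaussian, independent of the positions:
  exponential moments of one-body velocity sums factorise.
* `integral_exp_mul_sq_gaussianReal` — `E e^{cW²} = (1 − 2c)^{-1/2}` for `W ∼ N(0,1)`, `c < 1/2`;
  `lintegral_exp_quad_stdGaussian` — `E e^{β(W₀² − W₁²)} = (1−2β)^{-1/2}(1+2β)^{-1/2}` on `ℝ³`, `|β| < 1/2`.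
* `quad_orth_one/vel/energy` — the traceless quadratic current `Q(v) = v₀² − v₁²` (`A = diag(1,−1,0)`, `b = 0`) is in the
  kinetic class: `Q ⊥ 1, v, |v|²` under the Maxwellian, `|Q| ≤ 1 + |v|²`.
* `KineticCurrentsWindowLDFamilyWithZero` — the input with `0 < σ` relaxed to `0 ≤ σ` (everything else verbatim);
  **`kineticCurrentsWindowLDFamily_false_with_sigma_zero : ¬ KineticCurrentsWindowLDFamilyWithZero`** — at `σ = 0`
  (diameter `hsDiameter 0 N = 0`, free flight `freeFlow₀`, homogeneous profiles `(1, 0, 1)`) the window average of `Q`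
  IS `Q(v_i)` for every window length, so the scale-`N` log-moment-generating function equals
  `(N+1) · Λ(β)`, `Λ(β) = −½ log(1 − 4β²) > 0` for every `β ≠ 0`, independently of `τ`: the bound `≤ e^{ε(N+1)}` fails for
  `ε < Λ(β)`. CONSEQUENCE FOR THE LINE: `0 < σ` is load-bearing for the kinetic input (not only for the crux, cf.
  `Negative/SigmaZero.lean`), and its window threshold `τ₀(ε)` cannot be uniform as `σ ↓ 0` (the window must contain
  `≳ Λ(β)/ε` collision times, i.e. `τ₀ ≳ σ⁻²`); a family-uniform typing must keep `σ` FIXED, as v8/v9 do.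
-/

noncomputable section

open MeasureTheory ProbabilityTheory Filter Set Topology Real
open scoped ENNReal NNReal

namespace Summit.AtomisticToContinuum.HydrodynamicLimit.Theorems.HydroLimitInBandNegative

open Literature.MathematicalPhysics.KineticTheory Literature.Analysis.FluidPDE
open Literature.Analysis.FunctionSpaces
open CorrectorPressureDecayNegative.FreeFlow (freeFlow₀)

/-! ## §1 Gaussian integrals of `exp (c x²)` -/

/-- **`E e^{cW²} = (1 − 2c)^{-1/2}`** for `W ∼ N(0,1)` and `c < 1/2` (Gaussian integral). [folklore] -/
theorem integral_exp_mul_sq_gaussianReal {c : ℝ} (hc : c < 1 / 2) :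
    ∫ x, Real.exp (c * x ^ 2) ∂gaussianReal 0 1 = (Real.sqrt (1 - 2 * c))⁻¹ := by
  rw [integral_gaussianReal_eq_integral_smul (by norm_num)]
  have hpt : ∀ x : ℝ, gaussianPDFReal 0 1 x • Real.exp (c * x ^ 2) =
      (Real.sqrt (2 * π))⁻¹ * Real.exp (-(1 / 2 - c) * x ^ 2) := by
    intro x
    rw [gaussianPDFReal, smul_eq_mul, mul_assoc, ← Real.exp_add]
    congr 1
    · simp
    · congr 1
      push_cast
      ring
  simp_rw [hpt]
  rw [integral_const_mul, integral_gaussian (1 / 2 - c)]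
  have h1 : 0 < 1 / 2 - c := by linarith
  have h2 : 0 < 1 - 2 * c := by linarith
  rw [inv_mul_eq_div, ← Real.sqrt_div' _ (by positivity : (0 : ℝ) ≤ 2 * π), ← Real.sqrt_inv]
  congr 1
  field_simp

/-- `x ↦ e^{c x²}` is integrable under `N(0,1)` for `c < 1/2`. [folklore] -/
theorem integrable_exp_mul_sq_gaussianReal {c : ℝ} (hc : c < 1 / 2) :
    Integrable (fun x : ℝ => Real.exp (c * x ^ 2)) (gaussianReal 0 1) := by
  have h1 : 0 < 1 / 2 - c := by linarith
  rw [gaussianReal_of_var_ne_zero 0 one_ne_zero]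
  refine (integrable_withDensity_iff_integrable_smul' (measurable_gaussianPDF 0 1)
    (Eventually.of_forall fun x => by rw [gaussianPDF]; exact ENNReal.ofReal_lt_top)).2 ?_
  have hpt : (fun x : ℝ => (gaussianPDF 0 1 x).toReal • Real.exp (c * x ^ 2)) =
      fun x => (Real.sqrt (2 * π))⁻¹ * Real.exp (-(1 / 2 - c) * x ^ 2) := by
    funext x
    rw [gaussianPDF, ENNReal.toReal_ofReal (gaussianPDFReal_nonneg 0 1 x), gaussianPDFReal, smul_eq_mul, mul_assoc,
      ← Real.exp_add]
    congr 1
    · simp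
    · congr 1
      push_cast
      ring
  rw [hpt]
  exact (integrable_exp_neg_mul_sq h1).const_mul _

/-- The `ℝ≥0∞` form of `integral_exp_mul_sq_gaussianReal`. [folklore] -/
theorem lintegral_exp_mul_sq_gaussianReal {c : ℝ} (hc : c < 1 / 2) :
    ∫⁻ x, ENNReal.ofReal (Real.exp (c * x ^ 2)) ∂gaussianReal 0 1 = ENNReal.ofReal ((Real.sqrt (1 - 2 * c))⁻¹) := by
  rw [← integral_exp_mul_sq_gaussianReal hc,
    ofReal_integral_eq_lintegral_ofReal (integrable_exp_mul_sq_gaussianReal hc)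
      (Eventually.of_forall fun x => (Real.exp_pos _).le)]

/-- **`E e^{β(W₀² − W₁²)} = (1 − 2β)^{-1/2} (1 + 2β)^{-1/2}`** under the standard Gaussian on `ℝ³`, `|β| < 1/2`
(independent coordinates). [folklore] -/
theorem lintegral_exp_quad_stdGaussian {β : ℝ} (hβ : |β| < 1 / 2) :
    ∫⁻ w, ENNReal.ofReal (Real.exp (β * ((w 0) ^ 2 - (w 1) ^ 2))) ∂stdGaussian V3 =
      ENNReal.ofReal ((Real.sqrt (1 - 2 * β))⁻¹) * ENNReal.ofReal ((Real.sqrt (1 + 2 * β))⁻¹) := by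
  have hβ1 : β < 1 / 2 := (abs_lt.1 hβ).2
  have hβ2 : -β < 1 / 2 := by linarith [(abs_lt.1 hβ).1]
  rw [← map_pi_eq_stdGaussian, lintegral_map (by fun_prop) (PiLp.continuous_toLp 2 _).measurable]
  -- factorise the integrand over the three coordinates
  set f : Fin 3 → ℝ → ℝ≥0∞ := fun i x =>
    if i = 0 then ENNReal.ofReal (Real.exp (β * x ^ 2)) else if i = 1 then ENNReal.ofReal (Real.exp (-β * x ^ 2)) else 1
    with hf
  have hfm : ∀ i, Measurable (f i) := by
    intro i
    simp only [hf]
    split_ifs <;> fun_prop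
  have hpt : ∀ x : Fin 3 → ℝ, ENNReal.ofReal (Real.exp (β * (((WithLp.toLp 2 x : V3) 0) ^ 2 - ((WithLp.toLp 2 x : V3) 1) ^ 2))) =
      ∏ i, f i (x i) := by
    intro x
    simp only [Fin.prod_univ_three, hf, Fin.isValue, ↓reduceIte, one_ne_zero,
      show (2 : Fin 3) ≠ 0 by decide, show (2 : Fin 3) ≠ 1 by decide, mul_one]
    rw [← ENNReal.ofReal_mul (Real.exp_pos _).le, ← Real.exp_add]
    congr 2
    ring
  simp_rw [hpt]
  rw [lintegral_fintype_prod_eq_prod' (fun _ : Fin 3 => gaussianReal 0 1) hfm]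
  simp only [Fin.prod_univ_three, hf, Fin.isValue, ↓reduceIte, one_ne_zero, show (2 : Fin 3) ≠ 0 by decide,
    show (2 : Fin 3) ≠ 1 by decide, lintegral_const, measure_univ, mul_one]
  rw [lintegral_exp_mul_sq_gaussianReal hβ1, lintegral_exp_mul_sq_gaussianReal hβ2]
  congr 3
  ring

/-! ## §2 The traceless quadratic current `Q(v) = v₀² − v₁²` is in the kinetic class -/

/-- The coefficient matrix `A = diag(1, −1, 0)` (traceless, symmetric). -/
def Aq : Fin 3 → Fin 3 → ℝ := fun j k => if j = k then (if j = 0 then 1 else if j = 1 then -1 else 0) else 0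

/-- The current generated by `A = diag(1,−1,0)`, `b = 0`, `G = 0`, `u₀ = 0` in the kinetic class is `Q(v) = v₀² − v₁²`.
[folklore] -/
theorem quad_eq (v : V3) :
    (∑ j : Fin 3, ∑ k : Fin 3, Aq j k * ((v - 0) j * (v - 0) k)) +
      (∑ j : Fin 3, (0 : V3) j * (v - 0) j) * (0 : ℝ) = (v 0) ^ 2 - (v 1) ^ 2 := by
  simp [Aq, Fin.sum_univ_three]
  ring

/-- Growth: `|Q(v)| ≤ 1 + |v|²`. [folklore] -/
theorem abs_quad_le (v : V3) : |(v 0) ^ 2 - (v 1) ^ 2| ≤ 1 * (1 + ‖v‖ ^ 2) := by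
  rw [norm_sq_eq_sum_sq v, Fin.sum_univ_three, one_mul, abs_le]
  constructor <;> nlinarith [sq_nonneg (v 0), sq_nonneg (v 1), sq_nonneg (v 2)]

/-- Integrals against the unit Maxwellian are standard-Gaussian expectations, in product coordinates. [folklore] -/
theorem integral_mul_localMaxwellian_eq_pi {g : V3 → ℝ} (hg : Measurable g) :
    ∫ v, g v * localMaxwellian 1 1 (0 : V3) v =
      ∫ x : Fin 3 → ℝ, g (WithLp.toLp 2 x) ∂Measure.pi (fun _ : Fin 3 => gaussianReal 0 1) := by
  simp_rw [mul_comm (g _) (localMaxwellian _ _ _ _), ← smul_eq_mul]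
  rw [integral_localMaxwellian_smul one_pos (0 : V3) g]
  simp only [Real.sqrt_one, one_smul, zero_add]
  exact integral_stdGaussian_eq_pi hg

/-- `Q ⊥ 1`: `E[W₀² − W₁²] = 0`. [folklore] -/
theorem quad_orth_one : ∫ v, ((v 0) ^ 2 - (v 1) ^ 2) * localMaxwellian 1 1 (0 : V3) v = 0 := by
  rw [integral_mul_localMaxwellian_eq_pi (by fun_prop)]
  rw [integral_sub (integrable_coord_pow_pi 0 2) (integrable_coord_pow_pi 1 2), integral_coord_pow_pi,
    integral_coord_pow_pi, sub_self]

/-- `Q ⊥ v`: `E[(W₀² − W₁²) W_j] = 0` (odd moments). [folklore] -/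
theorem quad_orth_vel (j : Fin 3) : ∫ v, ((v 0) ^ 2 - (v 1) ^ 2) * v j * localMaxwellian 1 1 (0 : V3) v = 0 := by
  rw [integral_mul_localMaxwellian_eq_pi (g := fun v => ((v 0) ^ 2 - (v 1) ^ 2) * v j) (by fun_prop)]
  have hpt : ∀ x : Fin 3 → ℝ, ((x 0) ^ 2 - (x 1) ^ 2) * x j = (x 0) ^ 2 * (x j) ^ 1 - (x 1) ^ 2 * (x j) ^ 1 :=
    fun x => by ring
  simp_rw [hpt]
  rw [integral_sub (integrable_coord_pow_mul_coord_pow_pi 0 j 2 1) (integrable_coord_pow_mul_coord_pow_pi 1 j 2 1),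
    integral_coord_sq_mul_coord_pi, integral_coord_sq_mul_coord_pi, sub_self]

/-- `Q ⊥ |v|²`: `E[(W₀² − W₁²)|W|²] = (3 + 1 + 1) − (1 + 3 + 1) = 0`. [folklore] -/
theorem quad_orth_energy : ∫ v, ((v 0) ^ 2 - (v 1) ^ 2) * ‖v‖ ^ 2 * localMaxwellian 1 1 (0 : V3) v = 0 := by
  classical
  rw [integral_mul_localMaxwellian_eq_pi (g := fun v => ((v 0) ^ 2 - (v 1) ^ 2) * ‖v‖ ^ 2) (by fun_prop)]
  simp only [norm_sq_eq_sum_sq]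
  have hpt : ∀ x : Fin 3 → ℝ, ((x 0) ^ 2 - (x 1) ^ 2) * ∑ l, (x l) ^ 2 =
      (∑ l, (x 0) ^ 2 * (x l) ^ 2) - ∑ l, (x 1) ^ 2 * (x l) ^ 2 := by
    intro x
    rw [sub_mul, Finset.mul_sum, Finset.mul_sum]
  simp_rw [hpt]
  rw [integral_sub (integrable_finsetSum _ fun l _ => integrable_coord_pow_mul_coord_pow_pi 0 l 2 2)
      (integrable_finsetSum _ fun l _ => integrable_coord_pow_mul_coord_pow_pi 1 l 2 2),
    integral_finsetSum _ fun l _ => integrable_coord_pow_mul_coord_pow_pi 0 l 2 2,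
    integral_finsetSum _ fun l _ => integrable_coord_pow_mul_coord_pow_pi 1 l 2 2]
  simp_rw [integral_coord_sq_mul_coord_sq_pi]
  have h02 : (0 : Fin 3) ≠ 2 := by decide
  have h12 : (1 : Fin 3) ≠ 2 := by decide
  have h01 : (0 : Fin 3) ≠ 1 := by decide
  simp [Fin.sum_univ_three, h02, h12, h01, h01.symm]
  all_goals norm_num

/-! ## §3 The kinetic window-LD input with `0 ≤ σ`, and its refutation at `σ = 0` -/

/-- `IdeatorOneSketch.KineticCurrentsWindowLDFamily` (crux tree `Cruxes/HydroLimitInBand/Lines/IdeatorOneSketch.lean`,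
skeleton v8/v9, §2) with the strict positivity `0 < σ` of the reduced density relaxed to `0 ≤ σ`; everything else
VERBATIM (family-uniform thresholds, `∀ s ∈ [0,t₁]` innermost, window quantifier `∃ τ₀ ∀ τ ≥ τ₀`). -/
def KineticCurrentsWindowLDFamilyWithZero : Prop :=
  ∃ η₀ : ℝ, 0 < η₀ ∧ ∀ (t₁ : ℝ) (a θ₀ : ℝ → T3 → ℝ) (u₀ : ℝ → T3 → V3),
    Continuous (Function.uncurry a) → Continuous (Function.uncurry θ₀) → Continuous (Function.uncurry u₀) →
    (∀ s x, 0 < a s x) → (∀ s x, 0 < θ₀ s x) →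
    ∀ σ : ℝ, 0 ≤ σ → (∀ s ∈ Set.Icc 0 t₁, σ ^ 3 * (⨆ x, a s x) ≤ η₀ * ∫ x, a s x) →
    ∀ Φ : (N : ℕ) → HardSphereFlow (Torus.geometry (Fin 3)) (hsDiameter σ N) (N + 1),
    ∀ (A : ℝ → T3 → Fin 3 → Fin 3 → ℝ) (b : ℝ → T3 → V3) (G : ℝ → T3 × ℝ → ℝ),
    Continuous (Function.uncurry A) → Continuous (Function.uncurry b) → Continuous (Function.uncurry G) →
    (let F := fun (s : ℝ) (y : T3 × V3) =>
       (∑ j : Fin 3, ∑ k : Fin 3, A s y.1 j k * ((y.2 - u₀ s y.1) j * (y.2 - u₀ s y.1) k)) +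
         (∑ j : Fin 3, b s y.1 j * (y.2 - u₀ s y.1) j) * G s (y.1, ‖y.2 - u₀ s y.1‖ ^ 2)
     (∃ C : ℝ, ∀ s ∈ Set.Icc 0 t₁, ∀ y : T3 × V3, |F s y| ≤ C * (1 + ‖y.2‖ ^ 2)) →
     (∀ s ∈ Set.Icc 0 t₁, ∀ x, ∫ v, F s (x, v) * localMaxwellian 1 (θ₀ s x) (u₀ s x) v = 0) →
     (∀ s ∈ Set.Icc 0 t₁, ∀ x (j : Fin 3),
        ∫ v, F s (x, v) * v j * localMaxwellian 1 (θ₀ s x) (u₀ s x) v = 0) →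
     (∀ s ∈ Set.Icc 0 t₁, ∀ x, ∫ v, F s (x, v) * ‖v‖ ^ 2 * localMaxwellian 1 (θ₀ s x) (u₀ s x) v = 0) →
     ∃ β₀ : ℝ, 0 < β₀ ∧ ∀ β : ℝ, |β| ≤ β₀ → ∀ ε : ℝ, 0 < ε → ∃ τ₀ : ℝ, 0 < τ₀ ∧ ∀ τ : ℝ, τ₀ ≤ τ →
     ∃ N₀ : ℕ, ∀ N : ℕ, N₀ ≤ N → ∀ s ∈ Set.Icc 0 t₁,
       ∫⁻ z, ENNReal.ofReal (Real.exp (β * ∑ i : Fin (N + 1),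
           (τ * ((N : ℝ) + 1) ^ (-(1 / 3 : ℝ)))⁻¹ *
             ∫ r in (0 : ℝ)..(τ * ((N : ℝ) + 1) ^ (-(1 / 3 : ℝ))), F s ((Φ N).flow r z i)))
         ∂(localGibbsLaw σ (a s) (u₀ s) (θ₀ s) N (Φ N)) ≤
       ENNReal.ofReal (Real.exp (ε * ((N : ℝ) + 1))))

/-- The moment generating factor `m(β) = (1−2β)^{-1/2}(1+2β)^{-1/2} = (1 − 4β²)^{-1/2}` exceeds `1` for `0 < |β| < 1/2`.
[folklore] -/
theorem one_lt_mgfFactor {β : ℝ} (hβ : |β| < 1 / 2) (hβ0 : β ≠ 0) :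
    1 < (Real.sqrt (1 - 2 * β))⁻¹ * (Real.sqrt (1 + 2 * β))⁻¹ := by
  have hβ1 : β < 1 / 2 := (abs_lt.1 hβ).2
  have hβ2 : -(1 / 2) < β := (abs_lt.1 hβ).1
  have h1 : 0 < 1 - 2 * β := by linarith
  have h2 : 0 < 1 + 2 * β := by linarith
  rw [← mul_inv, ← Real.sqrt_mul h1.le, one_lt_inv_iff₀]
  refine ⟨Real.sqrt_pos.2 (mul_pos h1 h2), ?_⟩
  rw [Real.sqrt_lt' one_pos, one_pow]
  nlinarith [sq_pos_of_ne_zero hβ0]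

/-- **TIGHTNESS OF `0 < σ` FOR THE KINETIC INPUT — `KineticCurrentsWindowLDFamilyWithZero` is FALSE.** At `σ = 0` the
diameter is `0`, the free flight `freeFlow₀` is a flow family, and for the homogeneous profiles `(a, u₀, θ₀) = (1, 0, 1)`
(guard `0 ≤ η₀`) and the fast current `Q(v) = v₀² − v₁²` (in the class: `quad_orth_*`, `abs_quad_le`) the window average
of `Q` along the free flight is `Q(vᵢ)` itself, for EVERY window `τ (N+1)^{-1/3}`; the velocities are i.i.d. standard
Gaussian under the local Gibbs law (`lintegral_exp_sum_vel_localGibbsMeasure`), so the exponential moment equals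
`m(β)^{N+1}` with `m(β) = (1 − 4β²)^{-1/2} > 1` (`lintegral_exp_quad_stdGaussian`), which is NOT `≤ e^{ε(N+1)}` for
`e^ε = √(m(β))`. Hence collisions are load-bearing for the kinetic window-LD input, and its window threshold `τ₀(ε)`
cannot be chosen uniformly in `σ ↓ 0`. [folklore] -/
theorem kineticCurrentsWindowLDFamily_false_with_sigma_zero : ¬ KineticCurrentsWindowLDFamilyWithZero := by
  rintro ⟨η₀, hη₀, H⟩
  haveI : IsProbabilityMeasure (volume : Measure T3) := by
    rw [volume_pi]; infer_instance
  have hguard : ∀ s ∈ Set.Icc (0 : ℝ) 0,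
      (0 : ℝ) ^ 3 * (⨆ x : T3, (fun (_ : ℝ) (_ : T3) => (1 : ℝ)) s x) ≤ η₀ * ∫ x : T3, (fun (_ : ℝ) (_ : T3) => (1 : ℝ)) s x := by
    intro s _
    simp only [ne_eq, OfNat.ofNat_ne_zero, not_false_eq_true, zero_pow, zero_mul, integral_const, smul_eq_mul, mul_one,
      probReal_univ]
    exact hη₀.le
  have H1 := H 0 (fun _ _ => 1) (fun _ _ => 1) (fun _ _ => 0) continuous_const continuous_const continuous_const
    (fun _ _ => one_pos) (fun _ _ => one_pos) 0 le_rfl hguard freeFlow₀ (fun _ _ => Aq) (fun _ _ => 0) (fun _ _ => 0)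
    continuous_const continuous_const continuous_const
  dsimp only at H1
  simp only [quad_eq] at H1
  obtain ⟨β₀, hβ₀, Hβ⟩ := H1 ⟨1, fun s _ y => abs_quad_le y.2⟩ (fun s _ x => quad_orth_one)
    (fun s _ x j => quad_orth_vel j) (fun s _ x => quad_orth_energy)
  -- the tilt: `β := min β₀ (1/4)`, so `0 < β ≤ β₀` and `|β| < 1/2`
  set β : ℝ := min β₀ (1 / 4) with hβdef
  have hβpos : 0 < β := lt_min hβ₀ (by norm_num)
  have hβle : |β| ≤ β₀ := by rw [abs_of_pos hβpos]; exact min_le_left _ _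
  have hβhalf : |β| < 1 / 2 := by
    rw [abs_of_pos hβpos]; exact (min_le_right _ _).trans_lt (by norm_num)
  -- the moment generating factor and the accuracy `ε := log √m`
  set m : ℝ := (Real.sqrt (1 - 2 * β))⁻¹ * (Real.sqrt (1 + 2 * β))⁻¹ with hmdef
  have hm1 : 1 < m := one_lt_mgfFactor hβhalf hβpos.ne'
  have hm0 : 0 < m := one_pos.trans hm1
  have hsm1 : 1 < Real.sqrt m := by rw [Real.lt_sqrt zero_le_one]; simpa using hm1
  have hsm_lt : Real.sqrt m < m := by
    nth_rewrite 2 [← Real.mul_self_sqrt hm0.le]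
    exact lt_mul_of_one_lt_left (by positivity) hsm1
  set ε : ℝ := Real.log (Real.sqrt m) with hεdef
  have hε : 0 < ε := Real.log_pos hsm1
  have hexpε : Real.exp ε = Real.sqrt m := Real.exp_log (by positivity)
  obtain ⟨τ₀, hτ₀, Hτ⟩ := Hβ β hβle ε hε
  obtain ⟨N₀, HN⟩ := Hτ τ₀ le_rfl
  have Hs := HN N₀ le_rfl 0 ⟨le_rfl, le_rfl⟩
  -- along the free flight the window average of `Q` is `Q(vᵢ)`
  set w : ℝ := τ₀ * ((N₀ : ℝ) + 1) ^ (-(1 / 3 : ℝ)) with hwdef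
  have hw : w ≠ 0 := (mul_pos hτ₀ (Real.rpow_pos_of_pos (by positivity) _)).ne'
  have havg : ∀ (z : Config (N₀ + 1) (Fin 3) T3) (i : Fin (N₀ + 1)),
      w⁻¹ * ∫ r in (0 : ℝ)..w, ((((freeFlow₀ N₀).flow r z i).2 0) ^ 2 - (((freeFlow₀ N₀).flow r z i).2 1) ^ 2) =
        ((z i).2 0) ^ 2 - ((z i).2 1) ^ 2 := by
    intro z i
    have hv : ∀ r : ℝ, ((freeFlow₀ N₀).flow r z i).2 = (z i).2 := fun r => rfl
    simp_rw [hv]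
    rw [intervalIntegral.integral_const, sub_zero, smul_eq_mul, ← mul_assoc, inv_mul_cancel₀ hw, one_mul]
  simp_rw [havg] at Hs
  -- the exponential moment factorises over the i.i.d. Gaussian velocities (tree: `Negative/Frame.lean`)
  rw [localGibbsLaw_eq] at Hs
  have hval : ∫⁻ z, ENNReal.ofReal (Real.exp (β * ∑ i, (((z i).2 0) ^ 2 - ((z i).2 1) ^ 2)))
      ∂localGibbsMeasure 0 (fun _ : T3 => (1 : ℝ)) (fun _ => (0 : V3)) (fun _ => (1 : ℝ)) N₀ =
        ENNReal.ofReal m ^ (N₀ + 1) := by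
    have h := CorrectorPressureDecayNegative.lintegral_exp_sum_vel_localGibbsMeasure one_pos one_pos (0 : V3)
      (σ := 0) (by norm_num) N₀ (ψ := fun w : V3 => β * ((w 0) ^ 2 - (w 1) ^ 2)) (by fun_prop)
    simp only [← Finset.mul_sum] at h
    rw [h, CorrectorPressureDecayNegative.gaussMeasure_zero_one, lintegral_exp_quad_stdGaussian hβhalf,
      ← ENNReal.ofReal_mul (inv_nonneg.2 (Real.sqrt_nonneg _))]
  rw [hval, ← ENNReal.ofReal_pow hm0.le, mul_comm ε, show ((N₀ : ℝ) + 1) = ((N₀ + 1 : ℕ) : ℝ) by push_cast; ring,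
    Real.exp_nat_mul, hexpε, ENNReal.ofReal_le_ofReal_iff (by positivity)] at Hs
  exact absurd Hs (not_le.2 (pow_lt_pow_left₀ hsm_lt (Real.sqrt_nonneg _) (Nat.succ_ne_zero _)))

end Summit.AtomisticToContinuum.HydrodynamicLimit.Theorems.HydroLimitInBandNegative

end
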